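import Summits.QuantumFields.YangMills.Theses.EquipartitionCriticality

/-!
# `SubgradientLogSqueeze`: subgradients of `f` when `f β + c log β` converges

Closes item stmt-QuantumFields-8765 of route `EquipartitionCriticality` (support item).

If `f β + c · log β → K` as `β → ∞`, then for every `ε > 0`, eventually in `β`, every
subgradient `p` of `f` at `β` (i.e. `f β + p (y - β) ≤ f y` for all `y > 0`) satisfies
`|β p + c| ≤ ε`, uniformly in `p`.

Proof (difference quotients over `[β, (1+t)β]` and `[β/(1+t), β]`, `t ↓ 0`): write
`g β = f β + c log β`. The chord inequality at `y = (1+t)β` gives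
`t β p ≤ g((1+t)β) - g β - c log(1+t)`, and at `y = β/(1+t)` it gives
`t β p ≥ (1+t)(g β - g(β/(1+t))) - c (1+t) log(1+t)`. Since `g` is eventually within `δ`
of `K` at `β`, `(1+t)β` and `β/(1+t)` simultaneously, and
`t - t² ≤ log(1+t) ≤ t`, both `c (t - log(1+t))` and `c ((1+t) log(1+t) - t)` are at most
`|c| t²`; choosing `|c| t ≤ ε/2` and `4(1+t)δ ≤ ε t` yields `|β p + c| ≤ ε`. No convexity of
`f` is needed (where no subgradient exists the claim is vacuous). This is the elementary
"equipartition" step behind `β · E_μ[action per site] → 3D/2` (with Griffiths' lemma).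
-/

namespace Summit.QuantumFields.YangMills.Theorems

open Filter Topology

/-- **Subgradient log-squeeze** (closes `SubgradientLogSqueeze`). If
`f β + c · log β → K` as `β → ∞` then, for every `ε > 0`, eventually in `β` every subgradient
`p` of `f` at `β` over `(0, ∞)` satisfies `|β p + c| ≤ ε` (uniformly in `p`): compare the
chords of `f` over `[β, (1+t)β]` and `[β/(1+t), β]` with `|c| t ≤ ε/2`, using
`t - t² ≤ log (1+t) ≤ t`. [folklore; Ruelle 1969, Griffiths 1966 for the use with convex
pressures] -/
theorem subgradientLogSqueeze_proof :
    Summit.QuantumFields.YangMills.Theses.EquipartitionCriticality.SubgradientLogSqueeze := by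
  unfold Summit.QuantumFields.YangMills.Theses.EquipartitionCriticality.SubgradientLogSqueeze
  intro f c K hg ε hε
  -- step `t` of the multiplicative increments `1 + t`, with `|c| t < ε / 2`
  obtain ⟨t, ht, hct⟩ : ∃ t : ℝ, 0 < t ∧ |c| * t < ε / 2 := exists_pos_mul_lt (half_pos hε) |c|
  have hl : (0 : ℝ) < 1 + t := by linarith
  -- tolerance `δ` on the convergence `f β + c log β → K`, with `4 (1 + t) δ < ε t`
  obtain ⟨δ, hδ, hδε⟩ : ∃ δ : ℝ, 0 < δ ∧ 4 * (1 + t) * δ < ε * t :=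
    exists_pos_mul_lt (mul_pos hε ht) (4 * (1 + t))
  have hK : ∀ᶠ β : ℝ in atTop, |f β + c * Real.log β - K| < δ := by
    simpa only [Real.dist_eq] using Metric.tendsto_nhds.1 hg δ hδ
  have h1 : ∀ᶠ β : ℝ in atTop, |f ((1 + t) * β) + c * Real.log ((1 + t) * β) - K| < δ :=
    (tendsto_id.const_mul_atTop hl).eventually hK
  have h2 : ∀ᶠ β : ℝ in atTop, |f (β / (1 + t)) + c * Real.log (β / (1 + t)) - K| < δ :=
    (tendsto_id.atTop_div_const hl).eventually hK
  filter_upwards [hK, h1, h2, eventually_gt_atTop 0] with β hβ hβ1 hβ2 hβpos p hp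
  -- logarithm bookkeeping
  rw [Real.log_mul hl.ne' hβpos.ne'] at hβ1
  rw [Real.log_div hβpos.ne' hl.ne'] at hβ2
  rw [abs_lt] at hβ hβ1 hβ2
  have hlog_le : Real.log (1 + t) ≤ t := by
    have := Real.log_le_sub_one_of_pos hl
    linarith
  have hlog_ge : t ≤ (1 + t) * Real.log (1 + t) := by
    have h := mul_le_mul_of_nonneg_left (Real.one_sub_inv_le_log_of_pos hl) hl.le
    have e : (1 + t) * (1 - (1 + t)⁻¹) = t := by
      rw [mul_sub, mul_inv_cancel₀ hl.ne']
      ring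
    linarith
  have htl : t * Real.log (1 + t) ≤ t * t := mul_le_mul_of_nonneg_left hlog_le ht.le
  -- the two error terms `c (t - log(1+t))` and `c ((1+t) log(1+t) - t)` are `≤ |c| t²`
  have hc1 : c * (t - Real.log (1 + t)) ≤ |c| * t * t :=
    calc c * (t - Real.log (1 + t)) ≤ |c| * (t - Real.log (1 + t)) :=
          mul_le_mul_of_nonneg_right (le_abs_self c) (by linarith)
      _ ≤ |c| * (t * t) := mul_le_mul_of_nonneg_left (by linarith) (abs_nonneg c)
      _ = |c| * t * t := by ring
  have hc2 : c * ((1 + t) * Real.log (1 + t) - t) ≤ |c| * t * t :=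
    calc c * ((1 + t) * Real.log (1 + t) - t) ≤ |c| * ((1 + t) * Real.log (1 + t) - t) :=
          mul_le_mul_of_nonneg_right (le_abs_self c) (by linarith)
      _ ≤ |c| * (t * t) := mul_le_mul_of_nonneg_left (by linarith) (abs_nonneg c)
      _ = |c| * t * t := by ring
  have hctt : |c| * t * t ≤ ε / 2 * t := mul_le_mul_of_nonneg_right hct.le ht.le
  have htδ : 0 < t * δ := mul_pos ht hδ
  -- the two chord inequalities
  have hup := hp ((1 + t) * β) (by positivity)
  have hlo := hp (β / (1 + t)) (by positivity)
  rw [abs_le]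
  constructor
  · -- lower bound, from the chord over `[β/(1+t), β]`
    have e : p * (β / (1 + t) - β) = -(t * (β * p)) / (1 + t) := by
      field_simp
      ring
    rw [e] at hlo
    have key : -(t * (β * p)) ≤ (f (β / (1 + t)) - f β) * (1 + t) := by
      rw [← div_le_iff₀ hl]
      linarith
    have h3 : f (β / (1 + t)) - f β < 2 * δ + c * Real.log (1 + t) := by linarith
    have h4 := mul_lt_mul_of_pos_right h3 hl
    refine le_of_mul_le_mul_left ?_ ht
    linarith
  · -- upper bound, from the chord over `[β, (1+t)β]`
    refine le_of_mul_le_mul_left ?_ ht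
    linarith

end Summit.QuantumFields.YangMills.Theorems
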